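import Literature.NumberTheory.Transcendental.KZCalculus
import Literature.NumberTheory.Transcendental.NashCubes
import Mathlib.LinearAlgebra.Matrix.Determinant.Basic
import Mathlib.Analysis.SpecialFunctions.Pow.Real

/-!
# Crux `LinRedNormalForm.HoffmanSpanInKZ` (stmt-KontsevichZagierPeriods-15044), line `Sketch`:
# the doubling move in every dimension (registered stub `stub_doublingMove`)

First lemma of the card `even-column-newton-pi-box` of this crux (`Cruxes/HoffmanSpanInKZ/Ideas/`):
**the doubling move**, for every `n` (the card asks `n ≥ 2`; the proof is uniform in `n`): the squaring
map `x ↦ (xᵢ²)ᵢ` is ONE change of variables (Kontsevich–Zagier rule 2) on the open cube `(0,1)ⁿ` —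
polynomial over `ℚ`, injective, onto the cube, Jacobian `∏ 2xᵢ` — carrying
`[(0,1)ⁿ, P/(1 - P²)]` to `[(0,1)ⁿ, 2⁻ⁿ/(1 - P)]`, `P = ∏ xᵢ` (values `∑_{k even} k⁻ⁿ = 2⁻ⁿ ζ(n)`); with
integrand additivity `1/(1-P) = 1/(1-P²) + P/(1-P²)` it realises `(1 - 2⁻ⁿ)·[ζ(n)] ≡ [λ(n)]` inside the
calculus (`λ(n) = ∑_{k odd} k⁻ⁿ`). Dimension `4` is the tree's `Negative/EulerFour.sq4`; this is the
uniform version the even column needs.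

Sources: M. Kontsevich, D. Zagier, *Periods* (2001), §1.2 rule (2); F. Beukers, J. A. C. Kolk, E. Calabi,
Nieuw Arch. Wisk. (4) 11 (1993) (the even/odd splitting of `ζ(n)`).
-/

noncomputable section

namespace Summit.KontsevichZagierPeriods.LinRedNormalForm.HoffmanSpanInKZ

open Set MeasureTheory MvPolynomial
open Literature.NumberTheory.Transcendental

variable {n : ℕ}

/-! ## The squaring map -/

/-- The squaring map `x ↦ (xᵢ²)ᵢ`. -/
def sqMap (n : ℕ) (x : Fin n → ℝ) : Fin n → ℝ := fun i => x i * x i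

/-- Its derivative `diag(2xᵢ)`, as a continuous linear map. -/
def sqDeriv (n : ℕ) (x : Fin n → ℝ) : (Fin n → ℝ) →L[ℝ] (Fin n → ℝ) :=
  LinearMap.toContinuousLinearMap (Matrix.toLin' (Matrix.diagonal fun i => 2 * x i))

/-- `sqDeriv` acts coordinatewise by `vᵢ ↦ 2xᵢvᵢ`. -/
theorem sqDeriv_apply (x v : Fin n → ℝ) (i : Fin n) : sqDeriv n x v i = 2 * x i * v i := by
  simp [sqDeriv, Matrix.mulVec_diagonal]

/-- `det (sqDeriv x) = ∏ᵢ 2xᵢ`. -/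
theorem det_sqDeriv (x : Fin n → ℝ) : (sqDeriv n x).det = ∏ i, 2 * x i := by
  rw [← Matrix.det_diagonal]
  exact LinearMap.det_toLin' _

/-- The squaring map is differentiable with derivative `sqDeriv`. -/
theorem hasFDerivAt_sqMap (x : Fin n → ℝ) : HasFDerivAt (sqMap n) (sqDeriv n x) x := by
  have p : ∀ i : Fin n, HasFDerivAt (fun y : Fin n → ℝ => y i)
      (ContinuousLinearMap.proj (R := ℝ) (φ := fun _ : Fin n => ℝ) i) x := fun i => hasFDerivAt_apply i x
  rw [hasFDerivAt_pi']
  intro i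
  refine ((p i).mul (p i)).congr_fderiv ?_
  ext v
  have : sqDeriv n x v i = 2 * x i * v i := sqDeriv_apply x v i
  simp [this]
  ring

/-- The squaring map is injective on the open cube (positive coordinates). -/
theorem injOn_sqMap : InjOn (sqMap n) (openUnitCube n) := by
  intro x hx y hy h
  funext i
  have e : x i * x i = y i * y i := congrFun h i
  nlinarith [(hx i).1, (hy i).1, (hx i).2, (hy i).2]

/-- The squaring map sends the open cube onto itself. -/
theorem image_sqMap : sqMap n '' openUnitCube n = openUnitCube n := by
  apply Subset.antisymm
  · rintro _ ⟨x, hx, rfl⟩ i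
    show 0 < x i * x i ∧ x i * x i < 1
    exact ⟨mul_pos (hx i).1 (hx i).1, by nlinarith [(hx i).1, (hx i).2]⟩
  · intro w hw
    refine ⟨fun i => Real.sqrt (w i), fun i => ⟨Real.sqrt_pos.mpr (hw i).1,
      (Real.sqrt_lt' one_pos).mpr (by simpa using (hw i).2)⟩, ?_⟩
    funext i
    exact Real.mul_self_sqrt (hw i).1.le

/-- The squaring map is `ℚ`-semialgebraic on the open cube (polynomial components). -/
theorem isSemialgebraicMapOn_sqMap : IsSemialgebraicMapOn ℚ (openUnitCube n) (sqMap n) := by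
  have h := isSemialgebraicMapOn_aeval (isSemialgebraic_openUnitCube (d := n))
    (fun i => X i * X i : Fin n → MvPolynomial (Fin n) ℚ)
  refine h.congr fun x _ => ?_
  funext j
  simp [sqMap]

/-- On the open cube of positive dimension the product of the coordinates lies in `(0,1)`. -/
theorem prod_mem_Ioo (hn : 0 < n) {x : Fin n → ℝ} (hx : x ∈ openUnitCube n) :
    (∏ i, x i) ∈ Ioo (0 : ℝ) 1 := by
  haveI : Nonempty (Fin n) := ⟨⟨0, hn⟩⟩
  refine ⟨Finset.prod_pos fun i _ => (hx i).1, ?_⟩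
  calc (∏ i, x i) < ∏ _i : Fin n, (1 : ℝ) :=
        Finset.prod_lt_prod_of_nonempty (fun i _ => (hx i).1) (fun i _ => (hx i).2) Finset.univ_nonempty
    _ = 1 := by simp

/-! ## The move -/

/-- **The doubling move** (card `even-column-newton-pi-box`, first lemma): for `P = ∏ xᵢ` on the open cube
`(0,1)ⁿ`, `[(0,1)ⁿ, P/(1 - P²)] ~ [(0,1)ⁿ, 2⁻ⁿ/(1 - P)]` by ONE change of variables `x ↦ (xᵢ²)ᵢ`
(rule 2). Stated for representations with the prescribed domains and integrands on them. -/
def DoublingMove : Prop :=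
  ∀ (n : ℕ), 2 ≤ n → ∀ (r r' : KZ.IntegralRep n), r.domain = {x | ∀ i, x i ∈ Ioo (0:ℝ) 1} →
    EqOn r.integrand (fun x => (∏ i, x i) / (1 - (∏ i, x i) ^ 2)) r.domain →
    r'.domain = {x | ∀ i, x i ∈ Ioo (0:ℝ) 1} →
    EqOn r'.integrand (fun x => (1 / 2 ^ n) / (1 - ∏ i, x i)) r'.domain →
    KZ.Equivalent r r'

/-- The doubling move in every dimension `n ≥ 1` (the card's `n ≥ 2` is not needed; `n = 0` is excluded
only because there `P = 1`): the difference of the two representations is ONE change-of-variables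
relation. -/
theorem doubling_mem_changeOfVariablesRel {n : ℕ} (hn : 1 ≤ n) (r r' : KZ.IntegralRep n)
    (hd : r.domain = {x | ∀ i, x i ∈ Ioo (0:ℝ) 1})
    (hi : EqOn r.integrand (fun x => (∏ i, x i) / (1 - (∏ i, x i) ^ 2)) r.domain)
    (hd' : r'.domain = {x | ∀ i, x i ∈ Ioo (0:ℝ) 1})
    (hi' : EqOn r'.integrand (fun x => (1 / 2 ^ n) / (1 - ∏ i, x i)) r'.domain) :
    KZ.of r - KZ.of r' ∈ KZ.changeOfVariablesRel := by
  have hdc : r.domain = openUnitCube n := hd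
  have hdc' : r'.domain = openUnitCube n := hd'
  refine ⟨n, r, r', sqMap n, fun x => sqDeriv n x, hdc ▸ isSemialgebraicMapOn_sqMap,
    fun x _ => (hasFDerivAt_sqMap x).hasFDerivWithinAt, hdc ▸ injOn_sqMap, ?_, fun x hx => ?_, rfl⟩
  · rw [hdc', hdc, image_sqMap]
  · have hxc : x ∈ openUnitCube n := hdc ▸ hx
    have hsq : sqMap n x ∈ r'.domain := by
      rw [hdc', ← image_sqMap]; exact mem_image_of_mem _ hxc
    obtain ⟨hP0, hP1⟩ := prod_mem_Ioo (by omega) hxc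
    rw [hi hx, hi' hsq, det_sqDeriv]
    show (∏ i, x i) / (1 - (∏ i, x i) ^ 2) = (1 / 2 ^ n) / (1 - ∏ i, sqMap n x i) * |∏ i, 2 * x i|
    have hprod : (∏ i, sqMap n x i) = (∏ i, x i) ^ 2 := by
      simp only [sqMap, Finset.prod_mul_distrib, sq]
    have h2 : (∏ i, 2 * x i) = 2 ^ n * ∏ i, x i := by
      rw [Finset.prod_mul_distrib]; simp
    rw [hprod, h2, abs_of_pos (by positivity)]
    have hne : (1 : ℝ) - (∏ i, x i) ^ 2 ≠ 0 := by nlinarith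
    have hne' : (1 : ℝ) - (∏ i, x i) ≠ 0 := by linarith
    have h2n : (2 : ℝ) ^ n ≠ 0 := by positivity
    field_simp

/-- **Registered stub `stub_doublingMove`**: the doubling move (card `even-column-newton-pi-box`). -/
theorem stub_doublingMove : DoublingMove := fun n hn r r' hd hi hd' hi' =>
  KZ.changeOfVariablesRel_subset_relations (doubling_mem_changeOfVariablesRel (by omega) r r' hd hi hd' hi')

end Summit.KontsevichZagierPeriods.LinRedNormalForm.HoffmanSpanInKZ
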